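import Summits.QuantumFields.BalabanUV.T4Continuum.Support.TorusSmallFieldGlobalGaugeSharpPrep
import Summits.QuantumFields.BalabanUV.T4Continuum.Support.NE3EnergyRateFlatClass
import Literature.MathematicalPhysics.QuantumFieldTheory.Balaban1983to89.T4AveragingDeficitNonAbelian
import HarnessLib

/-!
# NE7NearFlatSharpPrep — THE LOOP LETTER behind the sharpness census of F29's «almost flat ⇒ near flat»: a unitary configuration that is bondwise
# `ρ`-close to a FLAT unitary configuration modulo a unitary gauge has EVERY closed-loop holonomy within `|loop|·ρ` of `1`

Cell `pub-balaban`, rung (B)+1 sub-cell t4, lineage `b2b-balaban-t4-ne7b-p1` (row NE7b OWNER + CRUX PROVER), generation 157; junction census for the NE7 road's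
located gaps (G1)∕(G2) of `t4/b2b-balaban-t4-ne7-p1-g113/ROAD-G113.md` §6 (data radius `δ_V` uniform in the torus size ∕ linear in the class radius; both located at
F29 `NE7SoftDataPath.exists_flat_near`: «almost flat ⇒ near flat» by compactness, `γ(ε′, N, n, d)` inexplicit).  Part 1 of 3: the tools.  Parts 2∕3
(`NE7NearFlatSharpAbelian`, `NE7NearFlatSharpHolonomy`) give the two witnesses — a `γ`-small datum at distance `≍ N·γ` from the flat data modulo gauge, and a
`t²`-small datum at distance `≳ t∕N` — so that F29's threshold necessarily obeys `γ ≤ C·ε′∕N` and `γ ≤ C·|n|·N²·ε′²`.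
WHAT ([folklore]; 0 def, 0 sorry).  §1 straight words: `hol_replicate_true_of_eq` ∕ `hol_replicate_false_of_eq` (a straight word all of whose bonds carry the same
group element `c` has holonomy `c^k` ∕ `(c⁻¹)^k`); §2 unitary bookkeeping: `mem_U1_of_mem_unitaryUnits`, `norm_inv_sub_inv_eq`, `norm_stepHol_sub_le`,
**`norm_hol_sub_hol_le_length`** (two `U(n)`-valued configurations bondwise within `ρ` have transporters along a word `w` within `|w|·ρ` — the LINEAR telescoping
bound; the tree's `B12LQLocalityBound267.norm_hol_sub_le` is the `(1+ρ)^{|w|} − 1` version for one-sided unitarity); §3 flat configurations: **`hol_eq_one_of_flat`**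
(zero curvature on `ℤ^d` ⇒ EVERY closed word has trivial holonomy — `NE3EnergyRateFlatClass.exists_unitary_gauge_eq_gaugeAct_flatCfg` + (8) along closed contours),
`norm_conj_sub_one_eq` (unitary conjugation preserves `‖· − 1‖`); §4 **`norm_hol_sub_one_le_of_near_flat`** — THE LOOP LETTER: `U(n)`-valued `V`, flat `U(n)`-valued
`F`, unitary site field `u`, `‖V^u(b) − F(b)‖ ≤ ρ` at every bond ⟹ `‖V(Γ) − 1‖ ≤ |Γ|·ρ` for every closed word `Γ` (no periodicity needed); §5 the torus corollary
**`exists_commuting_pair_near_axisHol`**: if moreover `V`, `F`, `u` are `N`-periodic then the two axis holonomies `V([0, N e_i])`, `V([0, N e_j])` are within `N·ρ`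
of a COMMUTING pair of unitaries (the conjugated axis holonomies of `F`, which commute: `axisHol_comm_of_flat`, the closed word
`[0,Ne_i]∪[Ne_i,Ne_i+Ne_j]∪(−)∪(−)` has trivial holonomy by §3 — the tree's `NE7ApeFlatEndOfRobustConst.hol_seg_comm_of_flat` re-derived on this import chain).
HONEST FRAMING (page 1): elementary lattice gauge kinematics; nothing of Bałaban's asserted; F29 and the road's ENDs are untouched (this is a census of the
MECHANISM «distance to flat data», not of the continuity method along small-curvature PATHS — see parts 2∕3); NE3∕NE7 NOT proved; row NE7b
(`T4WeightBudget.RelWeightBound`) NOT PRINTED ∕ NOT PROVED; spine count = dagwriter's call; finite T⁴ rung (B)+1 — NOT infinite volume, NOT mass gap, NOT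
BetaPertH, NOT Clay (continuum YM on T⁴ ⇐ BetaPertH ∧ nine spine estimates).
-/

set_option autoImplicit false

open scoped BigOperators Matrix Matrix.Norms.L2Operator
open Finset NormedSpace Complex

namespace Summit.QuantumFields.BalabanUV.T4Continuum.NE7NearFlatSharpPrep

open Literature.MathematicalPhysics.QuantumFieldTheory.Balaban1983to89
open B7Prop1Explicit B7Prop2Explicit
open T4AveragingDeficitWall hiding Site Plane Plaq Bond
open T4AveragingDeficitWallBoundary (IsPeriodicCfg)
open T4AveragingDeficitNonAbelian (hol_add_period)
open NE3EnergyShapes (IsUnitarySite IsPeriodicSite)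
open NE3EnergyRateFlatClass (exists_unitary_gauge_eq_gaugeAct_flatCfg)
open MinimalActionWitness (flatCfg)
open AveragingDeficitKDatum (isUnitaryCfg_gaugeAct)
open UnitaryCayleyPath (norm_coe_le_one)

noncomputable section

variable {d : ℕ} {n : Type*} [Fintype n] [DecidableEq n]

/-! ## §1 Straight words whose bonds carry one group element -/

section Straight

variable {G : Type*} [Group G]

/-- A forward straight word of `k` steps in direction `μ` all of whose bonds carry `c` has holonomy `c^k`. [folklore] -/
theorem hol_replicate_true_of_eq (V : Site d → Fin d → G) (μ : Fin d) (c : G) :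
    ∀ (k : ℕ) (x : Site d), (∀ j : ℕ, j < k → V (x + (j : ℤ) • e μ) μ = c) → hol V x (List.replicate k (μ, true)) = c ^ k
  | 0, x, _ => by simp
  | k + 1, x, h => by
    rw [List.replicate_succ, hol_cons, stepHol_true, Letter.vec_true, pow_succ']
    have h0 : V x μ = c := by simpa using h 0 (Nat.succ_pos k)
    rw [h0, hol_replicate_true_of_eq V μ c k (x + e μ) fun j hj => ?_]
    have := h (j + 1) (by omega)
    rw [← this]
    congr 1
    push_cast
    rw [add_assoc, add_comm (e μ), ← add_one_zsmul]

/-- A backward straight word of `k` steps in direction `μ` all of whose bonds carry `c` has holonomy `(c⁻¹)^k`. [folklore] -/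
theorem hol_replicate_false_of_eq (V : Site d → Fin d → G) (μ : Fin d) (c : G) :
    ∀ (k : ℕ) (x : Site d), (∀ j : ℕ, j < k → V (x - ((j : ℤ) + 1) • e μ) μ = c) → hol V x (List.replicate k (μ, false)) = c⁻¹ ^ k
  | 0, x, _ => by simp
  | k + 1, x, h => by
    rw [List.replicate_succ, hol_cons, stepHol_false, pow_succ']
    have h0 : V (x - e μ) μ = c := by simpa using h 0 (Nat.succ_pos k)
    have hv : Letter.vec ((μ, false) : Letter d) = -e μ := by simp [Letter.vec]
    rw [h0, hv, ← sub_eq_add_neg, hol_replicate_false_of_eq V μ c k (x - e μ) fun j hj => ?_]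
    have := h (j + 1) (by omega)
    rw [← this]
    congr 1
    push_cast
    rw [sub_sub, ← one_add_zsmul]
    ring_nf

end Straight

/-! ## §2 Unitary bookkeeping: norms of bonds, inverses, and the linear telescoping bound -/

section UnitaryBook

/-- A `U(n)`-valued unit lies in B7's class `U1` (`‖u‖ ≤ 1`, `‖u⁻¹‖ ≤ 1`; via `UnitaryCayleyPath.norm_coe_le_one`). [folklore] -/
theorem mem_U1_of_mem_unitaryUnits [Nonempty n] {u : (Matrix n n ℂ)ˣ} (hu : u ∈ unitaryUnits (Matrix n n ℂ)) : u ∈ U1 (Matrix n n ℂ) :=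
  mem_U1.mpr ⟨norm_coe_le_one hu, norm_coe_le_one ((unitaryUnits (Matrix n n ℂ)).inv_mem hu)⟩

/-- Inverses of `U(n)`-valued units are as close as the units themselves. [folklore] -/
theorem norm_inv_sub_inv_eq {u v : (Matrix n n ℂ)ˣ} (hu : u ∈ unitaryUnits (Matrix n n ℂ)) (hv : v ∈ unitaryUnits (Matrix n n ℂ)) :
    ‖((u⁻¹ : (Matrix n n ℂ)ˣ) : Matrix n n ℂ) - ((v⁻¹ : (Matrix n n ℂ)ˣ) : Matrix n n ℂ)‖ = ‖(u : Matrix n n ℂ) - (v : Matrix n n ℂ)‖ := by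
  -- `W⁻¹ = W⋆` for unitary units (the tree's `T4TermwiseUN.val_inv_eq_star`, inlined to keep the import chain short)
  have hu' : ((u⁻¹ : (Matrix n n ℂ)ˣ) : Matrix n n ℂ) = star (u : Matrix n n ℂ) :=
    Units.inv_eq_of_mul_eq_one_left (Unitary.star_mul_self_of_mem (mem_unitaryUnits.mp hu))
  have hv' : ((v⁻¹ : (Matrix n n ℂ)ˣ) : Matrix n n ℂ) = star (v : Matrix n n ℂ) :=
    Units.inv_eq_of_mul_eq_one_left (Unitary.star_mul_self_of_mem (mem_unitaryUnits.mp hv))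
  rw [hu', hv', ← star_sub, norm_star]

/-- One step: bondwise `ρ`-close `U(n)`-valued configurations have `ρ`-close step transporters. [folklore] -/
theorem norm_stepHol_sub_le {V V' : Site d → Fin d → (Matrix n n ℂ)ˣ} (hV : IsUnitaryCfg V) (hV' : IsUnitaryCfg V') {ρ : ℝ}
    (hρ : ∀ (x : Site d) (κ : Fin d), ‖((V' x κ : (Matrix n n ℂ)ˣ) : Matrix n n ℂ) - (V x κ : Matrix n n ℂ)‖ ≤ ρ) (x : Site d) (l : Letter d) :
    ‖((stepHol V' x l : (Matrix n n ℂ)ˣ) : Matrix n n ℂ) - ((stepHol V x l : (Matrix n n ℂ)ˣ) : Matrix n n ℂ)‖ ≤ ρ := by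
  unfold stepHol
  split_ifs
  · exact hρ _ _
  · rw [norm_inv_sub_inv_eq (hV' _ _) (hV _ _)]; exact hρ _ _

/-- **THE LINEAR TELESCOPING BOUND.**  Two `U(n)`-valued configurations bondwise within `ρ` have transporters along any word `w` within `|w|·ρ`. [folklore] -/
theorem norm_hol_sub_hol_le_length {V V' : Site d → Fin d → (Matrix n n ℂ)ˣ} (hV : IsUnitaryCfg V) (hV' : IsUnitaryCfg V') {ρ : ℝ}
    (hρ : ∀ (x : Site d) (κ : Fin d), ‖((V' x κ : (Matrix n n ℂ)ˣ) : Matrix n n ℂ) - (V x κ : Matrix n n ℂ)‖ ≤ ρ) :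
    ∀ (x : Site d) (w : List (Letter d)),
      ‖((hol V' x w : (Matrix n n ℂ)ˣ) : Matrix n n ℂ) - ((hol V x w : (Matrix n n ℂ)ˣ) : Matrix n n ℂ)‖ ≤ (w.length : ℝ) * ρ
  | x, [] => by simp
  | x, l :: w => by
    have ih := norm_hol_sub_hol_le_length hV hV' hρ (x + l.vec) w
    have hs := norm_stepHol_sub_le hV hV' hρ x l
    have ha : ‖((stepHol V x l : (Matrix n n ℂ)ˣ) : Matrix n n ℂ)‖ ≤ 1 :=
      norm_coe_le_one (stepHol_mem_of (S := unitaryUnits (Matrix n n ℂ)) hV x l)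
    have hb' : ‖((hol V' (x + l.vec) w : (Matrix n n ℂ)ˣ) : Matrix n n ℂ)‖ ≤ 1 :=
      norm_coe_le_one (hol_mem_of (S := unitaryUnits (Matrix n n ℂ)) hV' _ _)
    rw [hol_cons, hol_cons, Units.val_mul, Units.val_mul, List.length_cons]
    set a := ((stepHol V x l : (Matrix n n ℂ)ˣ) : Matrix n n ℂ)
    set a' := ((stepHol V' x l : (Matrix n n ℂ)ˣ) : Matrix n n ℂ)
    set b := ((hol V (x + l.vec) w : (Matrix n n ℂ)ˣ) : Matrix n n ℂ)
    set b' := ((hol V' (x + l.vec) w : (Matrix n n ℂ)ˣ) : Matrix n n ℂ)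
    have hρ0 : 0 ≤ ρ := (norm_nonneg _).trans (hρ x l.1)
    calc ‖a' * b' - a * b‖ = ‖(a' - a) * b' + a * (b' - b)‖ := by congr 1; noncomm_ring
      _ ≤ ‖a' - a‖ * ‖b'‖ + ‖a‖ * ‖b' - b‖ := (norm_add_le _ _).trans (add_le_add (norm_mul_le _ _) (norm_mul_le _ _))
      _ ≤ ρ * 1 + 1 * ((w.length : ℝ) * ρ) := by
          gcongr
      _ = ((w.length + 1 : ℕ) : ℝ) * ρ := by push_cast; ring

end UnitaryBook

/-! ## §3 Flat configurations: every closed word has trivial holonomy; unitary conjugation preserves the distance to `1` -/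

section Flat

/-- The trivial configuration has trivial transporters. [folklore] -/
theorem hol_flatCfg {G : Type*} [Group G] : ∀ (x : Site d) (w : List (Letter d)), hol (fun (_ : Site d) (_ : Fin d) => (1 : G)) x w = 1
  | _, [] => rfl
  | x, l :: w => by
    rw [hol_cons, hol_flatCfg (x + l.vec) w, mul_one]
    unfold stepHol
    split_ifs <;> simp

variable [Nonempty n]

/-- **ZERO CURVATURE ⇒ TRIVIAL HOLONOMY ALONG EVERY CLOSED WORD** (`ℤ^d` is simply connected: a flat `U(n)`-valued configuration is a pure gauge,
`NE3EnergyRateFlatClass.exists_unitary_gauge_eq_gaugeAct_flatCfg`, and (8) along a closed contour conjugates the trivial transporter). [folklore] -/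
theorem hol_eq_one_of_flat {F : Site d → Fin d → (Matrix n n ℂ)ˣ} (hFu : IsUnitaryCfg F)
    (hflat : ∀ (x : Site d) (κ μ : Fin d), κ ≠ μ → hol F x (plaqWord κ μ) = 1) (x : Site d) {w : List (Letter d)} (hw : disp w = 0) :
    hol F x w = 1 := by
  obtain ⟨g, -, hF⟩ := exists_unitary_gauge_eq_gaugeAct_flatCfg hFu hflat
  rw [hF, hol_gaugeAct_closed _ _ _ _ hw]
  have h1 : hol (flatCfg : Site d → Fin d → (Matrix n n ℂ)ˣ) x w = 1 := hol_flatCfg x w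
  rw [h1, mul_one, mul_inv_cancel]

/-- Unitary conjugation preserves `‖· − 1‖`. [folklore] -/
theorem norm_conj_sub_one_eq {u : (Matrix n n ℂ)ˣ} (hu : u ∈ unitaryUnits (Matrix n n ℂ)) (X : Matrix n n ℂ) :
    ‖(u : Matrix n n ℂ) * X * ((u⁻¹ : (Matrix n n ℂ)ˣ) : Matrix n n ℂ) - 1‖ = ‖X - 1‖ := by
  refine le_antisymm (norm_units_conj_sub_one_le (mem_U1_of_mem_unitaryUnits hu) X) ?_
  have h := norm_units_inv_conj_sub_one_le (mem_U1_of_mem_unitaryUnits hu) ((u : Matrix n n ℂ) * X * ((u⁻¹ : (Matrix n n ℂ)ˣ) : Matrix n n ℂ))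
  have he : ((u⁻¹ : (Matrix n n ℂ)ˣ) : Matrix n n ℂ) * ((u : Matrix n n ℂ) * X * ((u⁻¹ : (Matrix n n ℂ)ˣ) : Matrix n n ℂ)) * (u : Matrix n n ℂ) = X := by
    rw [← mul_assoc, ← mul_assoc, Units.inv_mul, one_mul, mul_assoc, Units.inv_mul, mul_one]
  rwa [he] at h

end Flat

/-! ## §4 THE LOOP LETTER: near a flat configuration modulo gauge, every closed-loop holonomy is near `1` -/

section Loop

variable [Nonempty n]

/-- **THE LOOP LETTER.**  Let `V` be `U(n)`-valued, `F` `U(n)`-valued and FLAT (every plaquette variable `1`), `u` a unitary site field, and suppose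
`‖V^u(b) − F(b)‖ ≤ ρ` at every bond.  Then for every CLOSED word `Γ` from any base point, `‖V(Γ) − 1‖ ≤ |Γ|·ρ`: the transporter of `V^u` is the
`u(x)`-conjugate of `V(Γ)` ((8) along closed contours), that of `F` is `1` (§3), and the two are within `|Γ|·ρ` (§2).  No periodicity is used. [folklore] -/
theorem norm_hol_sub_one_le_of_near_flat {V F : Site d → Fin d → (Matrix n n ℂ)ˣ} (hVu : IsUnitaryCfg V) (hFu : IsUnitaryCfg F)
    (hflat : ∀ (x : Site d) (κ μ : Fin d), κ ≠ μ → hol F x (plaqWord κ μ) = 1) {u : Site d → (Matrix n n ℂ)ˣ} (hu : IsUnitarySite u) {ρ : ℝ}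
    (hρ : ∀ (x : Site d) (κ : Fin d), ‖((gaugeAct u V x κ : (Matrix n n ℂ)ˣ) : Matrix n n ℂ) - (F x κ : Matrix n n ℂ)‖ ≤ ρ)
    (x : Site d) {w : List (Letter d)} (hw : disp w = 0) :
    ‖((hol V x w : (Matrix n n ℂ)ˣ) : Matrix n n ℂ) - 1‖ ≤ (w.length : ℝ) * ρ := by
  have h1 := norm_hol_sub_hol_le_length hFu (isUnitaryCfg_gaugeAct hu hVu) hρ x w
  rw [hol_eq_one_of_flat hFu hflat x hw, hol_gaugeAct_closed _ _ _ _ hw, Units.val_one, Units.val_mul, Units.val_mul,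
    norm_conj_sub_one_eq (hu x)] at h1
  exact h1

/-- **THE LOOP LETTER, CONTRAPOSED**: a closed word `Γ` with `‖V(Γ) − 1‖ > |Γ|·ρ` certifies that `V` is NOT bondwise `ρ`-close to any flat `U(n)`-valued
configuration modulo any unitary gauge. [folklore] -/
theorem lt_norm_sub_of_loop {V F : Site d → Fin d → (Matrix n n ℂ)ˣ} (hVu : IsUnitaryCfg V) (hFu : IsUnitaryCfg F)
    (hflat : ∀ (x : Site d) (κ μ : Fin d), κ ≠ μ → hol F x (plaqWord κ μ) = 1) {u : Site d → (Matrix n n ℂ)ˣ} (hu : IsUnitarySite u) {ρ : ℝ}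
    (x : Site d) {w : List (Letter d)} (hw : disp w = 0) (hbig : (w.length : ℝ) * ρ < ‖((hol V x w : (Matrix n n ℂ)ˣ) : Matrix n n ℂ) - 1‖) :
    ∃ (y : Site d) (κ : Fin d), ρ < ‖((gaugeAct u V y κ : (Matrix n n ℂ)ˣ) : Matrix n n ℂ) - (F y κ : Matrix n n ℂ)‖ := by
  by_contra h
  push Not at h
  exact absurd (norm_hol_sub_one_le_of_near_flat hVu hFu hflat hu h x hw) (not_le.mpr hbig)

end Loop

/-! ## §5 The torus corollary: the axis holonomies are near a COMMUTING pair of unitaries -/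

section Axis

variable [Nonempty n]

/-- The axis commutator word `[0, N e_i] ∪ [N e_i, N e_i + N e_j] ∪ (−[N e_j, N e_i + N e_j]) ∪ (−[0, N e_j])` is closed. [folklore] -/
theorem disp_axisCommutatorWord (N : ℕ) (i j : Fin d) :
    disp (seg i (N : ℤ) ++ seg j (N : ℤ) ++ revWord (seg i (N : ℤ)) ++ revWord (seg j (N : ℤ))) = 0 := by
  simp only [disp_append, disp_seg, disp_revWord]
  abel

/-- **THE AXIS HOLONOMIES OF A FLAT PERIODIC `U(n)`-VALUED CONFIGURATION COMMUTE** (based at `0`): the axis commutator word is closed, so its holonomy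
`P_i · P_j · P_i⁻¹ · P_j⁻¹` (periodicity moves the base points back to `0`) is `1` by §3 (the tree's `NE7ApeFlatEndOfRobustConst.hol_seg_comm_of_flat`,
re-derived on this import chain). [folklore] -/
theorem axisHol_comm_of_flat {N : ℕ} {F : Site d → Fin d → (Matrix n n ℂ)ˣ} (hFu : IsUnitaryCfg F) (hFP : IsPeriodicCfg F (N : ℤ))
    (hflat : ∀ (x : Site d) (κ μ : Fin d), κ ≠ μ → hol F x (plaqWord κ μ) = 1) (i j : Fin d) :
    hol F 0 (seg i (N : ℤ)) * hol F 0 (seg j (N : ℤ)) = hol F 0 (seg j (N : ℤ)) * hol F 0 (seg i (N : ℤ)) := by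
  have h1 := hol_eq_one_of_flat hFu hflat 0 (disp_axisCommutatorWord N i j)
  rw [hol_append, hol_append, hol_append] at h1
  simp only [disp_append, disp_seg, disp_revWord, zero_add] at h1
  have hPj : hol F ((N : ℤ) • e i) (seg j (N : ℤ)) = hol F 0 (seg j (N : ℤ)) := by
    simpa using hol_add_period hFP i (seg j (N : ℤ)) 0
  have hPi' : hol F ((N : ℤ) • e i + (N : ℤ) • e j) (revWord (seg i (N : ℤ))) = (hol F 0 (seg i (N : ℤ)))⁻¹ := by
    rw [hol_revWord' F (x := (N : ℤ) • e j) ((N : ℤ) • e i + (N : ℤ) • e j) (seg i (N : ℤ)) (by rw [disp_seg, add_comm])]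
    simpa using hol_add_period hFP j (seg i (N : ℤ)) 0
  have hPj' : hol F ((N : ℤ) • e i + (N : ℤ) • e j + -((N : ℤ) • e i)) (revWord (seg j (N : ℤ))) = (hol F 0 (seg j (N : ℤ)))⁻¹ := by
    rw [show ((N : ℤ) • e i + (N : ℤ) • e j + -((N : ℤ) • e i) : Site d) = (N : ℤ) • e j by abel]
    exact hol_revWord' F (x := 0) ((N : ℤ) • e j) (seg j (N : ℤ)) (by rw [disp_seg, zero_add])
  rw [hPj, hPi', hPj'] at h1
  -- `P_i P_j P_i⁻¹ P_j⁻¹ = 1`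
  calc hol F 0 (seg i (N : ℤ)) * hol F 0 (seg j (N : ℤ))
      = hol F 0 (seg i (N : ℤ)) * hol F 0 (seg j (N : ℤ)) * (hol F 0 (seg i (N : ℤ)))⁻¹ * (hol F 0 (seg j (N : ℤ)))⁻¹
          * (hol F 0 (seg j (N : ℤ)) * hol F 0 (seg i (N : ℤ))) := by group
    _ = hol F 0 (seg j (N : ℤ)) * hol F 0 (seg i (N : ℤ)) := by rw [h1, one_mul]

/-- **ONE AXIS.**  If `V`, `F` are `U(n)`-valued, `u` is a unitary `N`-periodic site field and `‖V^u(b) − F(b)‖ ≤ ρ` at every bond, then the axis holonomy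
`V([0, N e_i])` is within `N·ρ` of the conjugated axis holonomy `u(0)⁻¹ F([0, N e_i]) u(0)` (§2 along the straight word + (8):
`V^u([0, N e_i]) = u(0) V([0, N e_i]) u(N e_i)⁻¹ = u(0) V([0, N e_i]) u(0)⁻¹`, and unitary conjugation is isometric). [folklore] -/
theorem norm_axisHol_sub_conj_le {N : ℕ} {V F : Site d → Fin d → (Matrix n n ℂ)ˣ} (hVu : IsUnitaryCfg V) (hFu : IsUnitaryCfg F)
    {u : Site d → (Matrix n n ℂ)ˣ} (hu : IsUnitarySite u) (huP : IsPeriodicSite u (N : ℤ)) {ρ : ℝ}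
    (hρ : ∀ (x : Site d) (κ : Fin d), ‖((gaugeAct u V x κ : (Matrix n n ℂ)ˣ) : Matrix n n ℂ) - (F x κ : Matrix n n ℂ)‖ ≤ ρ) (i : Fin d) :
    ‖((hol V 0 (seg i (N : ℤ)) : (Matrix n n ℂ)ˣ) : Matrix n n ℂ) - (((u 0)⁻¹ * hol F 0 (seg i (N : ℤ)) * u 0 : (Matrix n n ℂ)ˣ) : Matrix n n ℂ)‖
      ≤ (N : ℝ) * ρ := by
  have h1 := norm_hol_sub_hol_le_length hFu (isUnitaryCfg_gaugeAct hu hVu) hρ 0 (seg i (N : ℤ))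
  rw [hol_gaugeAct, disp_seg, zero_add, show u ((N : ℤ) • e i) = u 0 by simpa using huP 0 i] at h1
  simp only [seg_natCast, List.length_replicate] at h1 ⊢
  have hu0 := mem_U1.mp (mem_U1_of_mem_unitaryUnits (hu 0))
  set H : Matrix n n ℂ := ((hol V 0 (List.replicate N (i, true)) : (Matrix n n ℂ)ˣ) : Matrix n n ℂ) with hH
  set P : Matrix n n ℂ := ((hol F 0 (List.replicate N (i, true)) : (Matrix n n ℂ)ˣ) : Matrix n n ℂ) with hP
  set a : Matrix n n ℂ := ((u 0 : (Matrix n n ℂ)ˣ) : Matrix n n ℂ) with ha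
  set a' : Matrix n n ℂ := (((u 0)⁻¹ : (Matrix n n ℂ)ˣ) : Matrix n n ℂ) with ha'
  have haa' : a * a' = 1 := by rw [ha, ha', Units.mul_inv]
  have ha'a : a' * a = 1 := by rw [ha, ha', Units.inv_mul]
  -- `a H a' − P = a (H − a' P a) a'`
  have he : a * H * a' - P = a * (H - a' * P * a) * a' := by
    have : a * (a' * P * a) * a' = P := by
      calc a * (a' * P * a) * a' = (a * a') * P * (a * a') := by noncomm_ring
        _ = P := by rw [haa', one_mul, mul_one]
    rw [mul_sub, sub_mul, this]
  rw [Units.val_mul, Units.val_mul, he] at h1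
  rw [Units.val_mul, Units.val_mul]
  calc ‖H - a' * P * a‖ = ‖a' * (a * (H - a' * P * a) * a') * a‖ := by
        congr 1
        calc H - a' * P * a = (a' * a) * (H - a' * P * a) * (a' * a) := by rw [ha'a, one_mul, mul_one]
          _ = a' * (a * (H - a' * P * a) * a') * a := by noncomm_ring
    _ ≤ ‖a'‖ * ‖a * (H - a' * P * a) * a'‖ * ‖a‖ := (norm_mul_le _ _).trans (mul_le_mul_of_nonneg_right (norm_mul_le _ _) (norm_nonneg _))
    _ ≤ 1 * ((N : ℝ) * ρ) * 1 := by
        have h0 : 0 ≤ 1 * ((N : ℝ) * ρ) := by rw [one_mul]; exact le_trans (norm_nonneg _) h1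
        exact mul_le_mul (mul_le_mul hu0.2 h1 (norm_nonneg _) zero_le_one) hu0.1 (norm_nonneg _) h0
    _ = (N : ℝ) * ρ := by ring

/-- **THE AXIS HOLONOMIES OF A CONFIGURATION NEAR A FLAT ONE (modulo a periodic unitary gauge) ARE NEAR A COMMUTING PAIR OF UNITARIES.**  If `V`, `F` are
`U(n)`-valued, `F` is `N`-periodic and flat, `u` is a unitary `N`-periodic site field and `‖V^u(b) − F(b)‖ ≤ ρ` at every bond, then for any two directions
`i, j` there are COMMUTING `U(n)`-valued `g_i, g_j` (the conjugated axis holonomies of `F`, which commute by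
`axisHol_comm_of_flat`) with `‖V([0, N e_i]) − g_i‖ ≤ N·ρ` and `‖V([0, N e_j]) − g_j‖ ≤ N·ρ`. [folklore] -/
theorem exists_commuting_pair_near_axisHol {N : ℕ} {V F : Site d → Fin d → (Matrix n n ℂ)ˣ} (hVu : IsUnitaryCfg V)
    (hFu : IsUnitaryCfg F) (hFP : IsPeriodicCfg F (N : ℤ))
    (hflat : ∀ (x : Site d) (κ μ : Fin d), κ ≠ μ → hol F x (plaqWord κ μ) = 1) {u : Site d → (Matrix n n ℂ)ˣ} (hu : IsUnitarySite u)
    (huP : IsPeriodicSite u (N : ℤ)) {ρ : ℝ}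
    (hρ : ∀ (x : Site d) (κ : Fin d), ‖((gaugeAct u V x κ : (Matrix n n ℂ)ˣ) : Matrix n n ℂ) - (F x κ : Matrix n n ℂ)‖ ≤ ρ) (i j : Fin d) :
    ∃ gi gj : (Matrix n n ℂ)ˣ, gi ∈ unitaryUnits (Matrix n n ℂ) ∧ gj ∈ unitaryUnits (Matrix n n ℂ) ∧ gi * gj = gj * gi ∧
      ‖((hol V 0 (seg i (N : ℤ)) : (Matrix n n ℂ)ˣ) : Matrix n n ℂ) - (gi : Matrix n n ℂ)‖ ≤ (N : ℝ) * ρ ∧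
      ‖((hol V 0 (seg j (N : ℤ)) : (Matrix n n ℂ)ˣ) : Matrix n n ℂ) - (gj : Matrix n n ℂ)‖ ≤ (N : ℝ) * ρ := by
  set Pi := hol F 0 (seg i (N : ℤ)) with hPi
  set Pj := hol F 0 (seg j (N : ℤ)) with hPj
  refine ⟨(u 0)⁻¹ * Pi * u 0, (u 0)⁻¹ * Pj * u 0, ?_, ?_, ?_, norm_axisHol_sub_conj_le hVu hFu hu huP hρ i,
    norm_axisHol_sub_conj_le hVu hFu hu huP hρ j⟩
  · exact (unitaryUnits _).mul_mem ((unitaryUnits _).mul_mem ((unitaryUnits _).inv_mem (hu 0)) (hol_mem_of (S := unitaryUnits (Matrix n n ℂ)) hFu _ _)) (hu 0)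
  · exact (unitaryUnits _).mul_mem ((unitaryUnits _).mul_mem ((unitaryUnits _).inv_mem (hu 0)) (hol_mem_of (S := unitaryUnits (Matrix n n ℂ)) hFu _ _)) (hu 0)
  · have hc : Pi * Pj = Pj * Pi := axisHol_comm_of_flat hFu hFP hflat i j
    calc (u 0)⁻¹ * Pi * u 0 * ((u 0)⁻¹ * Pj * u 0) = (u 0)⁻¹ * (Pi * Pj) * u 0 := by group
      _ = (u 0)⁻¹ * (Pj * Pi) * u 0 := by rw [hc]
      _ = (u 0)⁻¹ * Pj * u 0 * ((u 0)⁻¹ * Pi * u 0) := by group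

end Axis

end

end Summit.QuantumFields.BalabanUV.T4Continuum.NE7NearFlatSharpPrep
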